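import Summits.ABC.StewartYu.PadicG3TwoBudgetKN
import Summits.ABC.StewartYu.PadicG3TwoSizesThirdN
import HarnessLib

/-!
# Cell abc-stewartyu, WP-L.P(2) (crux r4 `PadicCoreTwoRat`, stmt-ABC-20504), record: the THIRD-STEP BUDGET LINE (L3) of `schedTwoN` — the
# gain branch of the Kummer-free `3`-descent's Liouville inequality at the padded letter

`Summits/ABC/StewartYu/PadicG3TwoBudgetTN.lean` — cell `abc-stewartyu`, route `YuMatveevShapeRat`, seat p3 (g10; memo-13 §1, STATUS 20:34Z v3).
Theorems only; twin of p3-g6's `PadicG3TwoBudgetT` on `schedTwoN`.  At level `I < I*N` the third step reads the family at `s/3`, `|s| ≤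
Nsub3N (I+1) 0 = 3·Xs3N (I+1)`, `3 ∤ s`, orders `< T03N (I+1)`; threshold `(6·thirdDenSat·thirdMSat·P(all)⁵)^{3^{n+1}−1}`.  COST per degree
`≤ (19/2)·Z` (`cost3N_le`: closed forms of `PadicG3TwoSizesThirdN` + the `Z`-atoms of `PadicG3TwoBudgetZN/ZBN/KN`; the third point's far height
`|s|·hboxvN (2A) I ≤ (4617/2048)·Z` (`sboxN_le_Z`), the basis slot `ucolvN ≤ Z/2^17`, the coefficient line through `log|b_θ| ≤ W_L` at the padded
letter (`log_bθ_le_WL`)).  GAIN `(2·3^{d+3}·Xs3N I + 1)·t₃·G ≥ (247/36)·(d+3)·3^{d+2}·Z` (`gain3N_ge`) with `t₃ ≥ (d+3)·T3N I/3` (`t3N_ge`: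
geometric regime `T3N (I+1) ≤ T3N I/3`, floored regime `T3N (I+1) = 8` paid by the reserve `16(n+2)`).  Hence **`hL3_gain_schedTwoN`** — the
third conjunct of `LinesSupplyTwoNW` for every admissible ledger.  WHAT THIS IS NOT: the instantiation at `parTwo`; no crux moves.

References: K. Yu, Acta Math. 211 (2013), Lemmas 5.3–5.4, (5.40)–(5.41), (5.58)–(5.70); Yu. V. Nesterenko, LNM 1819 (2003), §4.3, Cor. 4.5.
-/

noncomputable section

open Finset Real
open scoped Nat
open Literature.NumberTheory.Transcendental
open Literature.NumberTheory.Transcendental.CW77 (heightProd)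
open Literature.NumberTheory.Transcendental.CW77.Setup (Tau tauNorm)

namespace Summit.ABC.StewartYu

namespace TwoSetup

open Summit.ABC.StewartYu.G3Boxes Summit.ABC.StewartYu.PadicG3Par

variable (S : TwoSetup) (F : S.SatData) (P : PadicG3Par (S.d + 1)) (Ucol : Fin (S.d + 1) → ℕ)

/-! ### The third-step multiplicity and gain -/

/-- **The third-step multiplicity**: `(d+3)·T3N I ≤ 3·t₃`, `t₃ = T03N I − (d+3)·T3N I − T03N (I+1)` (exact subtraction for `I < I*N`).
[cite: Yu2013, (5.58); shape only] -/
theorem t3N_ge {I : ℕ} (hI : I < S.Istar3N F P) :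
    ((S.d : ℝ) + 3) * (S.T3N P I : ℝ) ≤
      3 * (((S.T03N F P I - (S.d + 3) * S.T3N P I - S.T03N F P (I + 1) : ℕ) : ℝ)) := by
  have hb := (S.T03N_budget F P I).2 hI
  have hsucc := S.T3N_succ_le P I
  have h3 : 3 * (S.T3N P I / 3) ≤ S.T3N P I := Nat.mul_div_le _ 3
  have e1 : (((S.T03N F P I - (S.d + 3) * S.T3N P I - S.T03N F P (I + 1) : ℕ)) : ℝ) =
      (S.T03N F P I : ℝ) - ((S.d : ℝ) + 3) * (S.T3N P I : ℝ) - (S.T03N F P (I + 1) : ℝ) := by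
    rw [Nat.cast_sub (by omega), Nat.cast_sub (by omega)]; push_cast; ring
  rw [e1]
  have eT : (S.T03N F P I : ℝ) - (S.T03N F P (I + 1) : ℝ) =
      2 * ((S.d : ℝ) + 3) * (S.T3N P I : ℝ) - 2 * ((S.d : ℝ) + 3) * (S.T3N P (I + 1) : ℝ) + 16 * ((S.d : ℝ) + 3) := by
    unfold T03N
    have h1 : I ≤ S.Istar3N F P + 1 := by omega
    have h2 : I + 1 ≤ S.Istar3N F P + 1 := by omega
    have h0 : I ≤ S.Istar3N F P := hI.le
    push_cast [Nat.cast_sub h1, Nat.cast_sub h2, Nat.cast_sub h0]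
    ring
  have hd0 : (0 : ℝ) ≤ (S.d : ℝ) + 3 := by positivity
  rcases le_max_iff.mp hsucc with h8 | hthird
  · have h8r : (S.T3N P (I + 1) : ℝ) ≤ 8 := by exact_mod_cast h8
    have := mul_le_mul_of_nonneg_left h8r hd0
    nlinarith
  · have hth : 3 * S.T3N P (I + 1) ≤ S.T3N P I := (Nat.mul_le_mul_left 3 hthird).trans h3
    have hthr : 3 * (S.T3N P (I + 1) : ℝ) ≤ (S.T3N P I : ℝ) := by exact_mod_cast hth
    have := mul_le_mul_of_nonneg_left hthr hd0
    nlinarith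

/-- **The third-step gain**: `(247/36)·(d+3)·3^{d+2}·Z ≤ (2·3^{d+3}·Xs3N I + 1)·t₃·G` (`Xs3N·T3N ≥ (247/72)·XL` at every level).
[cite: Yu2013, (5.40)–(5.41); shape only] -/
theorem gain3N_ge {I : ℕ} (hI : I < S.Istar3N F P) :
    (247 / 36) * ((S.d : ℝ) + 3) * (3 : ℝ) ^ (S.d + 2) * (P.G * P.X * P.L) ≤
      (((2 * (3 ^ (S.d + 3) * S.Xs3N P I) + 1) * (S.T03N F P I - (S.d + 3) * S.T3N P I - S.T03N F P (I + 1)) : ℕ) : ℝ) *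
        P.G := by
  have hGpos : 0 < P.G := by linarith [P.eight_le_G]
  have hXT := S.Xs3N_mul_T3N_ge P I
  have ht' := S.t3N_ge F P hI
  set t : ℕ := S.T03N F P I - (S.d + 3) * S.T3N P I - S.T03N F P (I + 1) with htdef
  push_cast
  have h3 : (0 : ℝ) ≤ (3 : ℝ) ^ (S.d + 3) := by positivity
  have hX0 : (0 : ℝ) ≤ (S.Xs3N P I : ℝ) := by positivity
  have ht0 : (0 : ℝ) ≤ (t : ℝ) := by positivity
  have h32 : (0 : ℝ) ≤ (3 : ℝ) ^ (S.d + 2) := by positivity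
  have h1 : 2 * (3 : ℝ) ^ (S.d + 2) * ((S.d : ℝ) + 3) * ((S.Xs3N P I : ℝ) * (S.T3N P I : ℝ)) ≤
      (2 * ((3 : ℝ) ^ (S.d + 3) * (S.Xs3N P I : ℝ)) + 1) * (t : ℝ) := by
    have e3 : (3 : ℝ) ^ (S.d + 3) = 3 * (3 : ℝ) ^ (S.d + 2) := by rw [pow_succ]; ring
    calc 2 * (3 : ℝ) ^ (S.d + 2) * ((S.d : ℝ) + 3) * ((S.Xs3N P I : ℝ) * (S.T3N P I : ℝ))
        = 2 * (3 : ℝ) ^ (S.d + 2) * (S.Xs3N P I : ℝ) * (((S.d : ℝ) + 3) * (S.T3N P I : ℝ)) := by ring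
      _ ≤ 2 * (3 : ℝ) ^ (S.d + 2) * (S.Xs3N P I : ℝ) * (3 * (t : ℝ)) :=
          mul_le_mul_of_nonneg_left ht' (by positivity)
      _ = (2 * ((3 : ℝ) ^ (S.d + 3) * (S.Xs3N P I : ℝ))) * (t : ℝ) := by rw [e3]; ring
      _ ≤ (2 * ((3 : ℝ) ^ (S.d + 3) * (S.Xs3N P I : ℝ)) + 1) * (t : ℝ) := by nlinarith
  have h2 : (247 / 36) * ((S.d : ℝ) + 3) * (3 : ℝ) ^ (S.d + 2) * (P.G * P.X * P.L) ≤
      2 * (3 : ℝ) ^ (S.d + 2) * ((S.d : ℝ) + 3) * ((S.Xs3N P I : ℝ) * (S.T3N P I : ℝ)) * P.G := by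
    have hc : (0 : ℝ) ≤ 2 * (3 : ℝ) ^ (S.d + 2) * ((S.d : ℝ) + 3) * P.G := by positivity
    have := mul_le_mul_of_nonneg_left hXT hc
    have e1 : 2 * (3 : ℝ) ^ (S.d + 2) * ((S.d : ℝ) + 3) * P.G * ((247 / 72) * P.X * P.L) =
        (247 / 36) * ((S.d : ℝ) + 3) * (3 : ℝ) ^ (S.d + 2) * (P.G * P.X * P.L) := by ring
    have e2 : 2 * (3 : ℝ) ^ (S.d + 2) * ((S.d : ℝ) + 3) * P.G * ((S.Xs3N P I : ℝ) * (S.T3N P I : ℝ)) =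
        2 * (3 : ℝ) ^ (S.d + 2) * ((S.d : ℝ) + 3) * ((S.Xs3N P I : ℝ) * (S.T3N P I : ℝ)) * P.G := by ring
    linarith
  have h3' := mul_le_mul_of_nonneg_right h1 hGpos.le
  linarith

/-! ### The per-degree cost -/

/-- `hsumS ≤ (d+1)·2ΣA ≤ Z/2^17` under `h(allₖ) ≤ 2ΣA`. [folklore] -/
theorem hsumS_le_ZN (hA1 : ∀ j, 1 ≤ P.A j) (hall : ∀ k, Height.logHeight₁ (S.toQ.all k) ≤ 2 * ∑ j, P.A j) :
    S.hsumS ≤ P.G * P.X * P.L / 2 ^ 17 := by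
  obtain ⟨hX36, hG8, hL25, hLG, hLL, hLH, hXL⟩ := S.base_facts P
  have hsA := S.sum_A_le P hA1
  have h1 : S.hsumS ≤ ((S.d : ℝ) + 1) * (2 * ∑ j, P.A j) := by
    unfold hsumS
    have hα : ∀ j, Height.logHeight₁ (S.α j) ≤ 2 * ∑ j, P.A j := by
      intro j; have := hall (Fin.castSucc j); simpa [SetupQ.all] using this
    have hθ : Height.logHeight₁ S.θ ≤ 2 * ∑ j, P.A j := by
      have := hall (Fin.last S.d); simpa [SetupQ.all] using this
    have hs : ∑ j, Height.logHeight₁ (S.α j) ≤ ∑ _j : Fin S.d, 2 * ∑ j, P.A j := Finset.sum_le_sum fun j _ => hα j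
    rw [Finset.sum_const, Finset.card_univ, Fintype.card_fin, nsmul_eq_mul] at hs
    linarith
  have hd0 : (0 : ℝ) ≤ (S.d : ℝ) := by positivity
  have hL0 : (0 : ℝ) ≤ P.L := by positivity
  have h2 : ((S.d : ℝ) + 1) * (2 * ∑ j, P.A j) ≤ ((S.d : ℝ) + 1 + 1) ^ 2 * P.L / 2 ^ 9 := by
    have := mul_le_mul_of_nonneg_left hsA (by positivity : (0 : ℝ) ≤ 2 * ((S.d : ℝ) + 1))
    rw [le_div_iff₀ (by norm_num)]
    nlinarith
  rw [le_div_iff₀ (by norm_num)]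
  rw [le_div_iff₀ (by norm_num)] at h2
  nlinarith

/-- **The basis slot**: `ucolvN (2A) ≤ Z/2^17` for `Ucol ≤ (d+1)·N`. [folklore] -/
theorem ucolvN_le_Z (hA1 : ∀ j, 1 ≤ P.A j) (hU : ∀ j, Ucol j ≤ (S.d + 1) * F.N) :
    S.ucolvN F Ucol (fun j => 2 * P.A j) ≤ P.G * P.X * P.L / 2 ^ 17 := by
  obtain ⟨hX36, hG8, hL25, hLG, hLL, hLH, hXL⟩ := S.base_facts P
  have hsA := S.sum_A_le P hA1
  have h1 := S.ucolvN_le F Ucol (Vo := fun j => 2 * P.A j) (fun j => by have := P.A_pos j; positivity) hU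
  rw [← Finset.mul_sum] at h1
  have hd0 : (0 : ℝ) ≤ (S.d : ℝ) := by positivity
  have hL0 : (0 : ℝ) ≤ P.L := by positivity
  have h2 : ((S.d : ℝ) + 1) * (2 * ∑ j, P.A j) ≤ ((S.d : ℝ) + 1 + 1) ^ 2 * P.L / 2 ^ 9 := by
    have := mul_le_mul_of_nonneg_left hsA (by positivity : (0 : ℝ) ≤ 2 * ((S.d : ℝ) + 1))
    rw [le_div_iff₀ (by norm_num)]
    nlinarith
  rw [le_div_iff₀ (by norm_num)]
  rw [le_div_iff₀ (by norm_num)] at h2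
  nlinarith

/-- **The third point's far height**: `|s| ≤ 3^{I+2}·X` and `|s|·hboxvN (2A) I ≤ (4617/2048)·Z` for `|s| ≤ 3·Xs3N (I+1)`.
[cite: Yu2013, (5.35); shape only] -/
theorem sboxN_le_Z (hA1 : ∀ j, 1 ≤ P.A j) {I : ℕ} {s : ℤ} (hs : |s| ≤ ((3 * S.Xs3N P (I + 1) : ℕ) : ℤ)) :
    |(s : ℝ)| ≤ (3 : ℝ) ^ (I + 2) * P.X ∧
      |(s : ℝ)| * S.hboxvN F P (fun j => 2 * P.A j) I ≤ (4617 / 2048) * (P.G * P.X * P.L) := by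
  obtain ⟨hX36, hG8, hL25, hLG, hLL, hLH, hXL⟩ := S.base_facts P
  have hL0 : (0 : ℝ) ≤ P.L := by positivity
  have hX0 : (0 : ℝ) ≤ P.X := by positivity
  have hd0 : (0 : ℝ) ≤ (S.d : ℝ) := by positivity
  have hs' : |(s : ℝ)| ≤ 3 * (S.Xs3N P (I + 1) : ℝ) := by
    have : ((|s| : ℤ) : ℝ) ≤ (((3 * S.Xs3N P (I + 1) : ℕ) : ℤ) : ℝ) := by exact_mod_cast hs
    push_cast at this; exact this
  have hXs := (S.Xs3N_lt P (I + 1)).le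
  have hsX : |(s : ℝ)| ≤ (3 : ℝ) ^ (I + 2) * P.X := by
    calc |(s : ℝ)| ≤ 3 * ((3 : ℝ) ^ (I + 1) * P.X) := hs'.trans (mul_le_mul_of_nonneg_left hXs (by norm_num))
      _ = (3 : ℝ) ^ (I + 2) * P.X := by rw [pow_succ]; ring
  refine ⟨hsX, ?_⟩
  have hu := S.box_unit_le P hA1
  have hh0 : 0 ≤ S.hboxvN F P (fun j => 2 * P.A j) I := S.hboxvN_nonneg F P (fun j => by have := P.A_pos j; positivity) I
  set U : ℝ := (1 + 1 / 2 ^ 9) * (((S.d : ℝ) + 1) * P.L) with hU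
  have hU0 : 0 ≤ U := by positivity
  -- `hboxvN I ≤ 2·U/3^I` at every level (`≤ U` at `I = 0`)
  have hhR : S.hboxvN F P (fun j => 2 * P.A j) I ≤ 2 / (3 : ℝ) ^ I * U := by
    rcases Nat.eq_zero_or_pos I with rfl | hI1
    · rw [pow_zero, div_one]
      have := (S.hboxvN_zero_le F P).trans hu
      linarith
    · exact (S.hboxvN_le_of_pos F P hI1).trans (mul_le_mul_of_nonneg_left hu (by positivity))
  have h3 : (0 : ℝ) < (3 : ℝ) ^ I := by positivity
  have hdN : ((S.d : ℝ) + 1) * (P.X * P.L) ≤ ((S.d : ℝ) + 1 + 1) * (P.X * P.L) := by nlinarith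
  calc |(s : ℝ)| * S.hboxvN F P (fun j => 2 * P.A j) I ≤ ((3 : ℝ) ^ (I + 2) * P.X) * (2 / (3 : ℝ) ^ I * U) :=
        mul_le_mul hsX hhR hh0 (by positivity)
    _ = 18 * (1 + 1 / 2 ^ 9) * (((S.d : ℝ) + 1) * (P.X * P.L)) := by rw [pow_add, hU]; field_simp; ring
    _ ≤ 18 * (1 + 1 / 2 ^ 9) * (((S.d : ℝ) + 1 + 1) * (P.X * P.L)) := mul_le_mul_of_nonneg_left hdN (by norm_num)
    _ = (4617 / 2048) * (8 * ((S.d : ℝ) + 1 + 1) * (P.X * P.L)) := by ring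
    _ ≤ (4617 / 2048) * (P.G * P.X * P.L) := mul_le_mul_of_nonneg_left hXL (by norm_num)

/-- **The coefficient letter at the padded record**: `log|b_θ| ≤ W_L` when `|ballₖ| ≤ (d+1)(d+1)!·N·e^{W₀}`, `W₀ + c_W(d) ≤ P.W`,
`N ≤ L/2^9`. [folklore] -/
theorem log_bθ_le_WL (hN : (F.N : ℝ) ≤ (2 / Real.log 2) ^ (S.d + 1) * P.Ω) {W₀ : ℝ}
    (hball : ∀ k, (|S.ball k| : ℝ) ≤ (((S.d + 1) * (S.d + 1)! : ℕ) : ℝ) * F.N * Real.exp W₀)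
    (hpad : W₀ + (cW S.d : ℝ) ≤ P.W) :
    0 ≤ Real.log (|(S.bθ : ℝ)|) ∧ Real.log (|(S.bθ : ℝ)|) ≤ P.WL := by
  have hb1 : (1 : ℝ) ≤ |(S.bθ : ℝ)| := by
    have : (1 : ℤ) ≤ |S.bθ| := Int.one_le_abs S.bθ_ne
    have : ((1 : ℤ) : ℝ) ≤ ((|S.bθ| : ℤ) : ℝ) := by exact_mod_cast this
    push_cast at this; exact this
  refine ⟨Real.log_nonneg hb1, ?_⟩
  have hθ : |(S.bθ : ℝ)| ≤ (((S.d + 1) * (S.d + 1)! : ℕ) : ℝ) * F.N * Real.exp W₀ := by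
    have := hball (Fin.last S.d); unfold ball at this; simpa using this
  have hN0 : (0 : ℝ) < F.N := by exact_mod_cast F.hN
  have hN1 : (1 : ℝ) ≤ F.N := by exact_mod_cast F.hN
  have hd1 : (1 : ℝ) ≤ (S.d : ℝ) + 1 := by have h0 : (0 : ℝ) ≤ S.d := Nat.cast_nonneg _; linarith
  have hfact : ((((S.d + 1) * (S.d + 1)! : ℕ)) : ℝ) ≤ ((S.d : ℝ) + 1) ^ (S.d + 2) := by
    have h := Nat.factorial_le_pow (S.d + 1)
    have h' : (((S.d + 1)! : ℕ) : ℝ) ≤ ((S.d : ℝ) + 1) ^ (S.d + 1) := by exact_mod_cast h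
    push_cast
    calc ((S.d : ℝ) + 1) * (((S.d + 1)! : ℕ) : ℝ) ≤ ((S.d : ℝ) + 1) * ((S.d : ℝ) + 1) ^ (S.d + 1) := by gcongr
      _ = ((S.d : ℝ) + 1) ^ (S.d + 2) := by ring
  have hpos : (0 : ℝ) < ((S.d : ℝ) + 1) ^ (S.d + 2) * F.N * Real.exp W₀ := by positivity
  have h1 : Real.log (|(S.bθ : ℝ)|) ≤ Real.log (((S.d : ℝ) + 1) ^ (S.d + 2) * F.N * Real.exp W₀) := by
    refine Real.log_le_log (by linarith) (hθ.trans ?_)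
    gcongr
  rw [Real.log_mul (by positivity) (Real.exp_pos _).ne', Real.log_mul (by positivity) hN0.ne', Real.log_pow, Real.log_exp] at h1
  have hcw := log_le_cW S.d
  have hl0 : 0 ≤ Real.log ((S.d : ℝ) + 1) := Real.log_nonneg hd1
  have h2 : ((S.d + 2 : ℕ) : ℝ) * Real.log ((S.d : ℝ) + 1) ≤ (cW S.d : ℝ) := by push_cast; nlinarith
  have hlogN := S.log_N_le_log_L F P hN
  have hWL := P.W_add_log_le_WL
  have hL0 : (0 : ℝ) < P.L := by linarith [P.one_le_L]
  rw [Real.log_mul (by norm_num) hL0.ne'] at hWL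
  have hlog2 : 0 ≤ Real.log 2 := Real.log_nonneg (by norm_num)
  linarith

/-- **The per-degree cost of the third step of `schedTwoN`**: for `I < I*N`, `|s| ≤ 3·Xs3N (I+1)`, `tauNorm τ < T03N (I+1)`,
`log 6 + log thirdDenSat + log thirdMSat + 5·log P(all) ≤ (19/2)·Z`, at the padded letter. [cite: Yu2013, Lemma 5.4 (5.58)–(5.70); shape only] -/
theorem cost3N_le (hG : P.G = (P.m + 2) * Real.log 2) (hy : 2 * P.G ≤ P.yload) (hNq : P.Nq = 2 ^ (P.m + 2))
    (hA1 : ∀ j, 1 ≤ P.A j) (hN : (F.N : ℝ) ≤ (2 / Real.log 2) ^ (S.d + 1) * P.Ω)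
    (hVo : ∀ j, Height.logHeight₁ (F.αo j) ≤ 2 * P.A j) (hall : ∀ k, Height.logHeight₁ (S.toQ.all k) ≤ 2 * ∑ j, P.A j)
    {W₀ : ℝ} (hball : ∀ k, (|S.ball k| : ℝ) ≤ (((S.d + 1) * (S.d + 1)! : ℕ) : ℝ) * F.N * Real.exp W₀)
    (hpad : W₀ + (cW S.d : ℝ) ≤ P.W) (hcW : (cW S.d : ℝ) ≤ P.W) (hU : ∀ j, Ucol j ≤ (S.d + 1) * F.N)
    {I : ℕ} (hI : I < S.Istar3N F P) {s : ℤ} (hs : |s| ≤ ((3 * S.Xs3N P (I + 1) : ℕ) : ℤ))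
    {τ : Tau S.d} (hτ : tauNorm τ < S.T03N F P (I + 1)) :
    Real.log 6 + Real.log (thirdDenSat (S.schedTwoN F P) F (S.Bv3N F P) Ucol I s τ : ℝ) +
        Real.log (thirdMSat (S.schedTwoN F P) F (S.Bv3N F P) Ucol I s τ) + 5 * Real.log (heightProd S.toQ.all) ≤
      (19 / 2) * (P.G * P.X * P.L) := by
  obtain ⟨hX36, hG8, hL25, hLG, hLL, hLH, hXL⟩ := S.base_facts P
  obtain ⟨hGZ, hNZ, h1Z⟩ := S.smalls_le_Z P
  set Z : ℝ := P.G * P.X * P.L with hZ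
  set N1 : ℝ := (S.d : ℝ) + 1 + 1 with hN1
  have hd0 : (0 : ℝ) ≤ (S.d : ℝ) := by positivity
  have hN1' : 2 ≤ N1 := by rw [hN1]; linarith
  have hGpos : 0 < P.G := by linarith [P.eight_le_G]
  have hL0 : (0 : ℝ) ≤ P.L := by positivity
  have hX0 : (0 : ℝ) ≤ P.X := by positivity
  have hHpos : (0 : ℝ) < P.H := by have : 1 ≤ P.H := le_max_left _ _; exact_mod_cast this
  have hX9 := P.X_le_nine_H
  -- orders: `tauNorm τ ≤ T03N 0 ≤ 14·N1·L`
  have hτ0 : tauNorm τ ≤ S.T03N F P 0 := le_trans hτ.le (S.T03N_le_zero F P (I + 1))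
  have ht1 : τ.1 ≤ S.T03N F P 0 := le_trans (by unfold tauNorm; omega) hτ0
  have ht1r : (τ.1 : ℝ) ≤ S.T03N F P 0 := by exact_mod_cast ht1
  have ht2 : ((∑ j, τ.2 j : ℕ) : ℝ) ≤ S.T03N F P 0 := by
    have : ∑ j, τ.2 j ≤ S.T03N F P 0 := le_trans (by unfold tauNorm; omega) hτ0
    exact_mod_cast this
  have hres := S.reserve_le_L F P hNq (S.N_le_L_nat F P hN)
  have hT := S.T03N_zero_le F P hres
  have hTN : (S.T03N F P 0 : ℝ) ≤ 14 * N1 * P.L := by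
    have h14 : 8 * ((S.d : ℝ) + 1) + 20 ≤ 14 * N1 := by rw [hN1]; linarith
    have := mul_le_mul_of_nonneg_right h14 hL0
    linarith
  have hNL : N1 * P.L ≤ Z / 576 := by
    have h2 : N1 * P.L * 576 ≤ N1 * P.L * (288 * N1) := mul_le_mul_of_nonneg_left (by linarith) (by positivity)
    rw [le_div_iff₀ (by norm_num)]; nlinarith
  obtain ⟨hsX, hsh⟩ := S.sboxN_le_Z F P hA1 (I := I) hs
  have hhs : S.hsumS ≤ Z / 2 ^ 17 := S.hsumS_le_ZN P hA1 hall
  have huc : S.ucolvN F Ucol (fun j => 2 * P.A j) ≤ Z / 2 ^ 17 := S.ucolvN_le_Z F P Ucol hA1 hU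
  have hVoZ := S.sum_Vo_le_Z P hA1
  have hVo2 : 2 * ∑ j, 2 * P.A j ≤ Z / 2 ^ 16 := by rw [show Z / 2 ^ 16 = (Z / 2 ^ 15) / 2 by ring]; linarith
  -- (a) `log thirdDenSat ≤ t₀ log ν(H) + |t| log|b_θ| + (2/3)|s| hboxvN + (4/3) ucolvN + 2ΣVo`
  have hDen := S.log_thirdDenSat_schedTwoN_le F P Ucol (Vo := fun j => 2 * P.A j) hVo I s τ
  have hν : (τ.1 : ℝ) * Real.log (Nat.lcmUpto P.H) ≤ (161 / 640) * Z := by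
    have hν' := NWPi.log_lcmUpto_le P.H
    have hν0 : 0 ≤ Real.log (Nat.lcmUpto P.H) := Real.log_nonneg (by exact_mod_cast Nat.lcmUpto_pos P.H)
    calc (τ.1 : ℝ) * Real.log (Nat.lcmUpto P.H) ≤ 14 * N1 * P.L * (23 / 20 * (P.H : ℝ)) :=
          mul_le_mul (ht1r.trans hTN) hν' hν0 (by positivity)
      _ = (161 / 640) * (64 * N1 * (P.L * P.H)) := by ring
      _ ≤ (161 / 640) * Z := by rw [hN1]; linarith
  obtain ⟨hlb0, hlb⟩ := S.log_bθ_le_WL F P hN hball hpad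
  have hbW : ((∑ j, τ.2 j : ℕ) : ℝ) * Real.log (|(S.bθ : ℝ)|) ≤ (7 / 32) * Z := by
    have hWLm := P.WL_mul_le; push_cast at hWLm
    calc ((∑ j, τ.2 j : ℕ) : ℝ) * Real.log (|(S.bθ : ℝ)|) ≤ 14 * N1 * P.L * P.WL :=
          mul_le_mul (ht2.trans hTN) hlb hlb0 (by positivity)
      _ = 14 * (N1 * P.L * P.WL) := by ring
      _ ≤ (7 / 32) * Z := by rw [hN1, hZ]; linarith
  -- (b) `log thirdMSat ≤ …`
  have hM := S.log_thirdMSat_schedTwoN_le F P Ucol (Vo := fun j => 2 * P.A j) hVo I s τ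
  have hc := S.log_cardBN_le_Z F P hy hA1 hN hcW
  have hAmax := S.log_Amax3N_le F P (Vo := fun j => 2 * P.A j) hVo
  have hM₀E := S.log_M₀E3N_le F P
  have hfar0 := S.siegel_far_le_Z F P hA1
  have hF0 : Real.log (S.feldSizeN F P 0 P.X (S.T03N F P 0)) ≤ (5 / 4) * Z + 2 * P.G + 25 * N1 := by
    refine S.log_feldSizeN_le_Z F P hG hy hNq hN 0 (by positivity) (k := 0) (by omega) ?_ le_rfl
    rw [Nat.sub_zero, pow_zero, mul_one]
    have h3 : (0 : ℝ) ≤ (3 : ℝ) ^ S.Istar3N F P := by positivity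
    calc (3 : ℝ) ^ S.Istar3N F P * (P.X : ℝ) ≤ (3 : ℝ) ^ S.Istar3N F P * (9 * P.H) := mul_le_mul_of_nonneg_left hX9 h3
      _ = 9 * (3 : ℝ) ^ S.Istar3N F P * P.H := by ring
  have hXb0 : (S.T03N F P 0 : ℝ) * Real.log (S.Xb3N F P 0 : ℝ) ≤ (21 / 32) * Z :=
    S.mul_log_Xb3N_le_Z F P hNq hA1 hN hball hpad 0 le_rfl
  have hlog3 := log_three_le
  have hlog2 := log_two_le
  have ht3 : (τ.1 : ℝ) * Real.log 3 ≤ (7 / 240) * Z := by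
    have hlog3pos : 0 ≤ Real.log 3 := Real.log_nonneg (by norm_num)
    calc (τ.1 : ℝ) * Real.log 3 ≤ 14 * N1 * P.L * (6 / 5) := mul_le_mul (ht1r.trans hTN) hlog3 hlog3pos (by positivity)
      _ = (84 / 5) * (N1 * P.L) := by ring
      _ ≤ (7 / 240) * Z := by linarith
  -- the Fel'dman size at level `I + 1`, point `|s| ≤ 3^{I+2} X ≤ 3^{I+2}·9H`
  have hF : Real.log (S.feldSizeN F P (I + 1) |(s : ℝ)| τ.1) ≤ (5 / 4) * Z + 2 * P.G + 25 * N1 := by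
    refine S.log_feldSizeN_le_Z F P hG hy hNq hN (I + 1) (abs_nonneg _) (k := 1) (by omega) ?_ ht1
    have hIle : I + 1 ≤ S.Istar3N F P := hI
    have h3I : (0 : ℝ) ≤ (3 : ℝ) ^ (S.Istar3N F P - (I + 1)) := by positivity
    have h1 : |(s : ℝ)| ≤ (3 : ℝ) ^ (I + 2) * (9 * P.H) := hsX.trans (mul_le_mul_of_nonneg_left hX9 (by positivity))
    have e3 : (3 : ℝ) ^ (S.Istar3N F P - (I + 1)) * (3 : ℝ) ^ (I + 2) = 3 * (3 : ℝ) ^ S.Istar3N F P := by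
      rw [← pow_add, show S.Istar3N F P - (I + 1) + (I + 2) = S.Istar3N F P + 1 by omega, pow_succ]; ring
    calc (3 : ℝ) ^ (S.Istar3N F P - (I + 1)) * |(s : ℝ)|
        ≤ (3 : ℝ) ^ (S.Istar3N F P - (I + 1)) * ((3 : ℝ) ^ (I + 2) * (9 * P.H)) := mul_le_mul_of_nonneg_left h1 h3I
      _ = 9 * (3 : ℝ) ^ S.Istar3N F P * (3 : ℝ) ^ 1 * P.H := by rw [← mul_assoc, e3, pow_one]; ring
  have hXb : ((∑ j, τ.2 j : ℕ) : ℝ) * Real.log (S.Xb3N F P I : ℝ) ≤ (21 / 32) * Z :=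
    S.mul_log_Xb3N_le_Z F P hNq hA1 hN hball hpad I ht2
  -- (c) `5 log P(all) = 5 hsumS`, `log 6 ≤ 1.9`
  have hP5 : Real.log (heightProd S.toQ.all) = S.hsumS := S.log_heightProd_all
  have hlog6 : Real.log 6 ≤ 19 / 10 := by
    rw [show (6 : ℝ) = 2 * 3 by norm_num, Real.log_mul (by norm_num) (by norm_num)]; linarith
  have hZ0 : 0 ≤ Z := by rw [hZ]; have := P.GXL_ge; linarith [show (0:ℝ) ≤ 16*72*2^25 by positivity]
  rw [hP5]
  -- assemble
  linarith only [hDen, hν, hbW, hsh, hhs, huc, hVo2, hM, hc, hAmax, hM₀E, hfar0, hF0, hXb0, hVoZ, ht3, hF, hXb, hlog6, hlog2,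
    hGZ, hNZ, h1Z, hZ0]

/-! ### The budget line -/

/-- **(L3) THE THIRD-STEP GAIN BRANCH of `schedTwoN`** at every level `I < I*N` — the third conjunct of `LinesSupplyTwoNW`, for every
admissible ledger. [cite: Yu2013, Lemma 5.4 (5.58)–(5.70)] [cite: Nesterenko2003, §4.3, Cor 4.5] -/
theorem hL3_gain_schedTwoN (hG : P.G = (P.m + 2) * Real.log 2) (hy : 2 * P.G ≤ P.yload) (hNq : P.Nq = 2 ^ (P.m + 2))
    (hA1 : ∀ j, 1 ≤ P.A j) (hN : (F.N : ℝ) ≤ (2 / Real.log 2) ^ (S.d + 1) * P.Ω)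
    (hVo : ∀ j, Height.logHeight₁ (F.αo j) ≤ 2 * P.A j) (hall : ∀ k, Height.logHeight₁ (S.toQ.all k) ≤ 2 * ∑ j, P.A j)
    {W₀ : ℝ} (hball : ∀ k, (|S.ball k| : ℝ) ≤ (((S.d + 1) * (S.d + 1)! : ℕ) : ℝ) * F.N * Real.exp W₀)
    (hpad : W₀ + (cW S.d : ℝ) ≤ P.W) (hcW : (cW S.d : ℝ) ≤ P.W) (hU : ∀ j, Ucol j ≤ (S.d + 1) * F.N) :
    ∀ I, I < S.Istar3N F P → ∀ s : ℤ, |s| ≤ (S.Nsub3N P (I + 1) 0 : ℤ) → ¬ (3 : ℤ) ∣ s →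
      ∀ τ : Tau S.d, tauNorm τ < S.T03N F P (I + 1) →
      S.Bw3N F P / (4 * (2 : ℝ) ^ P.m) ^
          ((2 * (3 ^ (S.d + 3) * S.Xs3N P I) + 1) * (S.T03N F P I - (S.d + 3) * S.T3N P I - S.T03N F P (I + 1))) <
        1 / (6 * (thirdDenSat (S.schedTwoN F P) F (S.Bv3N F P) Ucol I s τ : ℝ) *
          thirdMSat (S.schedTwoN F P) F (S.Bv3N F P) Ucol I s τ * heightProd S.toQ.all ^ 5) ^ (3 ^ (S.d + 1 + 1) - 1) := by
  intro I hI s hs _h3 τ hτ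
  have hNs : S.Nsub3N P (I + 1) 0 = 3 * S.Xs3N P (I + 1) := by unfold Nsub3N; simp
  rw [hNs] at hs
  -- positivity of the threshold's factors
  have hD : (0 : ℝ) < (thirdDenSat (S.schedTwoN F P) F (S.Bv3N F P) Ucol I s τ : ℝ) := by
    have : 1 ≤ thirdDenSat (S.schedTwoN F P) F (S.Bv3N F P) Ucol I s τ := by
      unfold thirdDenSat
      refine one_le_mul (one_le_mul ?_ (Nat.one_le_pow _ _ (Int.natAbs_pos.mpr S.bθ_ne))) (F.one_le_DmOf _)
      rw [schedTwoN_den₀]; exact Nat.one_le_pow _ _ (Nat.lcmUpto_pos P.H)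
    exact_mod_cast this
  have hMpos : (0 : ℝ) < thirdMSat (S.schedTwoN F P) F (S.Bv3N F P) Ucol I s τ := lt_of_lt_of_le one_pos (le_max_left _ _)
  have hPh : (0 : ℝ) < heightProd S.toQ.all := lt_of_lt_of_le one_pos (CW77.one_le_heightProd _)
  have hK : (0 : ℝ) < (6 * (thirdDenSat (S.schedTwoN F P) F (S.Bv3N F P) Ucol I s τ : ℝ) *
      thirdMSat (S.schedTwoN F P) F (S.Bv3N F P) Ucol I s τ * heightProd S.toQ.all ^ 5) ^ (3 ^ (S.d + 1 + 1) - 1) := by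
    positivity
  refine branch_gain_lt_of_log (S.Bw3N_pos F P) hK (by positivity) ?_
  rw [S.log_rho_eq_G P hG, log_thr_eq hD hMpos hPh]
  have hc := S.cost3N_le F P Ucol hG hy hNq hA1 hN hVo hall hball hpad hcW hU hI hs hτ
  have hg := S.gain3N_ge F P hI
  have hBw := S.log_Bw3N_le_Z F P hG hy
  obtain ⟨hGZ, hNZ, h1Z⟩ := S.smalls_le_Z P
  have hZ : (0 : ℝ) < P.G * P.X * P.L := by have := P.GXL_ge; linarith [show (0:ℝ) < 16*72*2^25 by positivity]
  -- the degree weight `e = 3^{d+2} − 1`, and `d + 3 ≥ 3`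
  have he : (((3 ^ (S.d + 1 + 1) - 1 : ℕ)) : ℝ) ≤ (3 : ℝ) ^ (S.d + 2) - 1 := by
    have h1 : 1 ≤ 3 ^ (S.d + 1 + 1) := Nat.one_le_pow _ _ (by norm_num)
    push_cast [Nat.cast_sub h1]
    exact le_of_eq (by ring)
  have he0 : (0 : ℝ) ≤ (((3 ^ (S.d + 1 + 1) - 1 : ℕ)) : ℝ) := by positivity
  have hd0 : (0 : ℝ) ≤ (S.d : ℝ) := by positivity
  have hd3 : (3 : ℝ) ≤ (S.d : ℝ) + 3 := by linarith
  have h32 : (0 : ℝ) ≤ (3 : ℝ) ^ (S.d + 2) := by positivity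
  set C₁ : ℝ := Real.log 6 + Real.log (thirdDenSat (S.schedTwoN F P) F (S.Bv3N F P) Ucol I s τ : ℝ) +
      Real.log (thirdMSat (S.schedTwoN F P) F (S.Bv3N F P) Ucol I s τ) + 5 * Real.log (heightProd S.toQ.all) with hC₁
  set Z : ℝ := P.G * P.X * P.L with hZdef
  have h13 : (1 : ℝ) ≤ (3 : ℝ) ^ (S.d + 2) := one_le_pow₀ (by norm_num)
  have hcost : Real.log (S.Bw3N F P) + (((3 ^ (S.d + 1 + 1) - 1 : ℕ)) : ℝ) * C₁ ≤ (3 : ℝ) ^ (S.d + 2) * ((19 / 2) * Z) := by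
    have hBw' : Real.log (S.Bw3N F P) ≤ (19 / 2) * Z := by linarith
    rcases le_or_gt 0 C₁ with hpos | hneg
    · have h1 : (((3 ^ (S.d + 1 + 1) - 1 : ℕ)) : ℝ) * C₁ ≤ ((3 : ℝ) ^ (S.d + 2) - 1) * ((19 / 2) * Z) :=
        mul_le_mul he hc hpos (by linarith)
      have e : ((3 : ℝ) ^ (S.d + 2) - 1) * ((19 / 2) * Z) = (3 : ℝ) ^ (S.d + 2) * ((19 / 2) * Z) - (19 / 2) * Z := by ring
      linarith
    · have h1 : (((3 ^ (S.d + 1 + 1) - 1 : ℕ)) : ℝ) * C₁ ≤ 0 := mul_nonpos_of_nonneg_of_nonpos he0 hneg.le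
      have h2 : (19 / 2) * Z ≤ (3 : ℝ) ^ (S.d + 2) * ((19 / 2) * Z) := by
        have := mul_le_mul_of_nonneg_right h13 (by positivity : (0:ℝ) ≤ (19 / 2) * Z)
        linarith
      linarith
  -- gain ≥ (247/36)(d+3)·3^{d+2}·Z ≥ (247/12)·3^{d+2}·Z > (19/2)·3^{d+2}·Z
  have hmono : 3 * ((3 : ℝ) ^ (S.d + 2) * Z) ≤ ((S.d : ℝ) + 3) * (3 : ℝ) ^ (S.d + 2) * Z := by
    have := mul_nonneg (sub_nonneg.mpr hd3) (mul_nonneg h32 hZ.le)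
    nlinarith
  have hpos : 0 < (3 : ℝ) ^ (S.d + 2) * Z := by positivity
  linarith

end TwoSetup

end Summit.ABC.StewartYu

end
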